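import Literature.MathematicalPhysics.QuantumFieldTheory.LatticeGaugeProofs
import HarnessLib

/-!
# Discharge: infinite-volume limit points of the torus Wilson states exist
(`Literature.MathematicalPhysics.QuantumLattice.infiniteVolumeLimitPoints_nonempty`)

Sibling proof file of `Literature/MathematicalPhysics/QuantumLattice/LatticeGaugeDLR.lean`
(trunk QLatticeAQFT, item A9): it discharges the named fact
`Literature.MathematicalPhysics.QuantumLattice.infiniteVolumeLimitPoints_nonempty` (D-0014) as
`Literature.MathematicalPhysics.QuantumLattice.infiniteVolumeLimitPoints_nonempty_holds`. No definition or statement is introduced.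

The fact: for a compact second-countable Hausdorff gauge group `G`, a continuous matrix
representation `ρ` and any inverse coupling `β`, the set `infiniteVolumeLimitPoints ρ β` of
subsequential limits (on bounded continuous cylinder observables) of the torus Wilson states
`μ_{Λ_{L+1}, β}`, transported to `G^{edges(ℤ^d)}` by the periodic lift, is non-empty
(Seiler LNP 159 Ch. 2; Chatterjee arXiv:1803.01950 §2: "by compactness").

## Proof

Soft compactness, assembled from Mathlib and the torus layer of
`Literature/MathematicalPhysics/QuantumFieldTheory/LatticeGaugeProofs.lean` (whence the import;
that file is downstream of `LatticeGaugeDLR.lean`, so the discharge cannot sit in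
`LatticeGaugeDLR.lean` itself):

1. `Literature.ConstructiveQFT.torusState ρ β (L+1)` — the torus Wilson state pushed forward along
   `torusLift (L+1)` — is a probability measure on `LGConfig d G` for continuous `ρ`
   (`isProbabilityMeasure_torusState`), and
   `wilsonExpectation ρ β (toTorusObservable (L+1) F) = ∫ F d(torusState ρ β (L+1))` for
   measurable `F` (`wilsonExpectation_toTorusObservable`).
2. `LGConfig d G = (edges → G)` is compact, Hausdorff, second countable (countable product), and
   its product σ-algebra is the Borel σ-algebra (`Pi.borelSpace`); hence Mathlib's
   `ProbabilityMeasure (LGConfig d G)` is compact (`instCompactSpaceProbabilityMeasure`,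
   Riesz–Markov / Prokhorov) and metrizable (Lévy–Prokhorov), so the sequence of torus states
   has a convergent subsequence (`IsCompact.tendsto_subseq`).
3. Weak convergence is convergence of integrals of bounded continuous functions
   (`ProbabilityMeasure.tendsto_iff_forall_integral_tendsto`), which is exactly the defining
   clause of `IsInfiniteVolumeLimitAlong` for bounded continuous cylinder observables.

## References

* E. Seiler, *Gauge Theories as a Problem of Constructive Quantum Field Theory and Statistical
  Mechanics*, LNP 159 (Springer 1982), Ch. 2 (infinite-volume limit by compactness).
* S. Chatterjee, *Yang–Mills for probabilists*, arXiv:1803.01950, §2 (infinite-volume Gibbs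
  measures of lattice gauge theories exist by compactness of `G^{edges}`).
-/

noncomputable section

open MeasureTheory Filter Topology
open Literature.MathematicalPhysics.QuantumFieldTheory

namespace Literature.MathematicalPhysics.QuantumLattice

variable {d N : ℕ} {G : Type*} [Group G] [TopologicalSpace G] [IsTopologicalGroup G]
  [CompactSpace G] [MeasurableSpace G] [BorelSpace G] (ρ : G →* Matrix (Fin N) (Fin N) ℂ)

/-- **Discharge of `infiniteVolumeLimitPoints_nonempty`.** For a continuous representation `ρ`
of the compact second-countable Hausdorff group `G` and every `β`, the torus Wilson states
`μ_{Λ_{L+1}, β}` (transported to `G^{edges(ℤ^d)}`) have a subsequence converging on all bounded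
continuous cylinder observables to a probability measure, i.e.
`(infiniteVolumeLimitPoints ρ β).Nonempty`: the space of probability measures on the compact
metrizable space `G^{edges(ℤ^d)}` is compact and metrizable (Mathlib:
`instCompactSpaceProbabilityMeasure`, Lévy–Prokhorov metrizability), and weak convergence is
convergence of integrals of bounded continuous functions (Seiler LNP 159 Ch. 2; Chatterjee
arXiv:1803.01950 §2). [cite: arXiv180301950] -/
theorem infiniteVolumeLimitPoints_nonempty_holds :
    infiniteVolumeLimitPoints_nonempty (d := d) ρ := by
  intro _ _ hρ β
  haveI := fun L : ℕ => isProbabilityMeasure_torusState (d := d) (L := L + 1) ρ hρ β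
  let P : ℕ → ProbabilityMeasure (LGConfig d G) := fun L => ⟨torusState ρ β (L + 1), inferInstance⟩
  obtain ⟨μ, -, φ, hφ, hlim⟩ :=
    (isCompact_univ (X := ProbabilityMeasure (LGConfig d G))).tendsto_subseq
      fun n => Set.mem_univ (P n)
  refine ⟨(μ : Measure (LGConfig d G)), φ, hφ, inferInstance, fun F S _ hFc hFb => ?_⟩
  obtain ⟨C, hC⟩ := hFb
  let Fb : BoundedContinuousFunction (LGConfig d G) ℝ :=
    BoundedContinuousFunction.ofNormedAddCommGroup F hFc C
      (fun U => by simpa [Real.norm_eq_abs] using hC U)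
  have hE : (fun k : ℕ => wilsonExpectation (L := φ k + 1) ρ β (toTorusObservable (φ k + 1) F)) =
      fun k => ∫ U, Fb U ∂(P (φ k) : Measure (LGConfig d G)) :=
    funext fun k => wilsonExpectation_toTorusObservable ρ β (φ k + 1) hFc.measurable
  have key : Tendsto (fun k : ℕ => ∫ U, Fb U ∂(P (φ k) : Measure (LGConfig d G))) atTop
      (𝓝 (∫ U, Fb U ∂(μ : Measure (LGConfig d G)))) :=
    (ProbabilityMeasure.tendsto_iff_forall_integral_tendsto.1 hlim) Fb
  rw [hE]
  exact key

end Literature.MathematicalPhysics.QuantumLattice
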